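import Literature.Probability.RandomPlanarGeometry.CurveSpace
import Literature.Probability.RandomPlanarGeometry.PlanarDomains
import HarnessLib

/-!
# Boundary typing of the crux `SimpleSubseqLimits` — the deterministic core of the pins
(crux stmt-CriticalPhenomena-4982, decl
`Summit.CriticalPhenomena.SAWScalingLimit.Theses.SAWLoopFugacityFlow.SimpleSubseqLimits`;
line `past-shadowing-costs-halves`, reshaping v3 = the A-side-free lattice line, stub `stub_boundaryCore`,
2026-08-16)

The BOUNDARY input of the line says the critical walk rarely visits the open `ε`-neighbourhood of
`∂D` at a point `ρ`-far from both marked points `D.pt 0`, `D.pt 1` of the Dobrushin domain `D`. The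
necessity pin needs the following purely deterministic fact about the metric space `CurveClass ℂ` of
planar curves modulo increasing reparametrisation:

* `stub_boundaryCore` — if a curve class `c` lies in the CLOSURE of the thickened configuration
  `{mk γ | ∃ t, infDist (γ t) ∂D < 1/(n+1) ∧ ρ < dist (γ t) (D.pt 0) ∧ ρ < dist (γ t) (D.pt 1)}` for
  every width `1/(n+1)`, then its trace actually TOUCHES `∂D` at a point at distance `≥ ρ` from both
  marked points.

Proof: fix a representative `e` of `c`. For each `n` a class in the configuration is `1/(n+1)`-close
to `mk e`; by `Curve.exists_dist_reparam_lt` and reparametrisation invariance of the configuration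
(`exists_visit_reparam`) there is a representative `γₙ` with `dist (e s) (γₙ s) < 1/(n+1)` for all `s`
and a witnessing time `tₙ` (`exists_close_representative`). Then
`infDist (e tₙ) ∂D < 2/(n+1)` and `dist (e tₙ) (D.pt i) > ρ - 1/(n+1)`. Along a convergent
subsequence `t_{ψ k} → t₁` of the compact parameter interval, `x := e t₁ ∈ c.range` has
`infDist x ∂D = 0`, so `x ∈ ∂D` (the frontier is closed, and nonempty by
`MarkedDomain.pt_mem_frontier`), and `ρ ≤ dist x (D.pt i)` by passing to the limit.
The hypothesis `0 < ρ` is part of the registered signature but not needed.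
-/

noncomputable section

open MeasureTheory Filter Topology Set Metric Function
open Literature.Probability.RandomPlanarGeometry
open scoped ENNReal NNReal BoundedContinuousFunction unitInterval

namespace Summit.CriticalPhenomena.SAWScalingLimit.Theorems.SimpleSubseqLimits.Boundary.Core

/-- The near-boundary-visit configuration `∃ t, infDist (γ t) ∂D < ε ∧ ρ < dist (γ t) (D.pt 0) ∧
ρ < dist (γ t) (D.pt 1)` is invariant under increasing reparametrisation (witness `φ.symm t`).
[folklore] -/
theorem exists_visit_reparam {D : DobrushinDomain} {γ : Curve ℂ} {ρ ε : ℝ}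
    (h : ∃ t : I, infDist (γ t) (frontier D.carrier) < ε ∧ ρ < dist (γ t) (D.pt 0) ∧
      ρ < dist (γ t) (D.pt 1)) (φ : I ≃o I) :
    ∃ t : I, infDist (γ.reparam φ t) (frontier D.carrier) < ε ∧
      ρ < dist (γ.reparam φ t) (D.pt 0) ∧ ρ < dist (γ.reparam φ t) (D.pt 1) := by
  obtain ⟨t, ht⟩ := h
  exact ⟨φ.symm t, by simpa only [Curve.reparam_apply, OrderIso.apply_symm_apply] using ht⟩

/-- **Sup-close representatives.** If `mk e` lies in the closure of the `1/(n+1)`-thickened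
near-boundary-visit event, some representative `γ` of a class in the event is uniformly
`1/(n+1)`-close to `e` (`Curve.exists_dist_reparam_lt` and reparametrisation invariance), with a
witnessing time `t`. [folklore] -/
theorem exists_close_representative (D : DobrushinDomain) (ρ : ℝ) (e : Curve ℂ) (n : ℕ)
    (h : CurveClass.mk e ∈ closure {c' : CurveClass ℂ | ∃ γ : Curve ℂ, CurveClass.mk γ = c' ∧
      ∃ t : I, Metric.infDist (γ t) (frontier D.carrier) < 1 / ((n : ℝ) + 1) ∧
        ρ < dist (γ t) (D.pt 0) ∧ ρ < dist (γ t) (D.pt 1)}) :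
    ∃ (γ : Curve ℂ) (t : I), infDist (γ t) (frontier D.carrier) < 1 / ((n : ℝ) + 1) ∧
      ρ < dist (γ t) (D.pt 0) ∧ ρ < dist (γ t) (D.pt 1) ∧
        ∀ s, dist (e s) (γ s) < 1 / ((n : ℝ) + 1) := by
  obtain ⟨b, hb, hd⟩ :=
    Metric.mem_closure_iff.1 h _ (by positivity : (0 : ℝ) < 1 / ((n : ℝ) + 1))
  obtain ⟨γ, rfl, hγ⟩ := hb
  rw [CurveClass.dist_mk_mk] at hd
  obtain ⟨φ, hφ⟩ := Curve.exists_dist_reparam_lt hd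
  obtain ⟨t, ht, h0, h1⟩ := exists_visit_reparam hγ φ
  exact ⟨γ.reparam φ, t, ht, h0, h1, fun s => (ContinuousMap.dist_apply_le_dist s).trans_lt hφ⟩

/-- `1/(ψ k + 1) → 0` along a strictly increasing `ψ : ℕ → ℕ`. [folklore] -/
theorem tendsto_one_div_subseq {ψ : ℕ → ℕ} (hψ : StrictMono ψ) :
    Tendsto (fun k : ℕ => 1 / ((ψ k : ℝ) + 1)) atTop (𝓝 0) := by
  have h1 : Tendsto (fun k : ℕ => 1 / ((k : ℝ) + 1)) atTop (𝓝 0) :=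
    tendsto_one_div_add_atTop_nhds_zero_nat
  refine squeeze_zero (fun k => by positivity) (fun k => ?_) h1
  have : (k : ℝ) ≤ ψ k := by exact_mod_cast hψ.id_le k
  exact one_div_le_one_div_of_le (by positivity) (by linarith)

/-- **Core of the pins** (registered stub `stub_boundaryCore`): a class lying in every closed
`1/(n+1)`-thickening of the near-boundary-visit event has a trace point ON `∂D` at distance `≥ ρ`
from both marked points — sup-close representatives, a convergent subsequence of the witnessing
times in the compact parameter interval, `frontier` closed and nonempty via
`MarkedDomain.pt_mem_frontier`, limits of the inequalities. [folklore] -/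
theorem stub_boundaryCore : ∀ (D : DobrushinDomain) (ρ : ℝ) (c : CurveClass ℂ), 0 < ρ → (∀ n : ℕ, c ∈ closure {c' : CurveClass ℂ | ∃ γ : Curve ℂ, CurveClass.mk γ = c' ∧ ∃ t : I, Metric.infDist (γ t) (frontier D.carrier) < 1 / ((n : ℝ) + 1) ∧ ρ < dist (γ t) (D.pt 0) ∧ ρ < dist (γ t) (D.pt 1)}) → ∃ x ∈ c.range, x ∈ frontier D.carrier ∧ ρ ≤ dist x (D.pt 0) ∧ ρ ≤ dist x (D.pt 1) := by
  intro D ρ c _ h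
  obtain ⟨e, rfl⟩ := CurveClass.surjective_mk c
  choose γ t hfr h0 h1 hclose using fun n => exists_close_representative D ρ e n (h n)
  obtain ⟨t₁, ψ, hψ, hlim⟩ := CompactSpace.tendsto_subseq t
  have herr : Tendsto (fun k : ℕ => 1 / ((ψ k : ℝ) + 1)) atTop (𝓝 0) := tendsto_one_div_subseq hψ
  have hek : Tendsto (fun k => e (t (ψ k))) atTop (𝓝 (e t₁)) :=
    (e.continuous.tendsto t₁).comp hlim
  -- passing to the limit in `ρ - 1/(ψ k + 1) < dist (e (t (ψ k))) p`
  have hfar : ∀ p : ℂ, (∀ n, ρ < dist (γ n (t n)) p) → ρ ≤ dist (e t₁) p := by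
    intro p hp
    have hA : Tendsto (fun k => dist (e (t (ψ k))) p) atTop (𝓝 (dist (e t₁) p)) :=
      hek.dist tendsto_const_nhds
    have hB : Tendsto (fun k => ρ - 1 / ((ψ k : ℝ) + 1)) atTop (𝓝 ρ) := by
      simpa only [sub_zero] using tendsto_const_nhds.sub herr
    refine le_of_tendsto_of_tendsto' hB hA fun k => ?_
    have hρk := hp (ψ k)
    have hd := hclose (ψ k) (t (ψ k))
    have htri := dist_triangle (γ (ψ k) (t (ψ k))) (e (t (ψ k))) p
    rw [dist_comm] at hd
    linarith
  refine ⟨e t₁, ⟨t₁, rfl⟩, ?_, hfar _ h0, hfar _ h1⟩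
  -- `infDist (e t₁) ∂D = 0`, and the frontier is closed and nonempty
  have hne : (frontier D.carrier).Nonempty := ⟨_, D.pt_mem_frontier 0⟩
  refine (isClosed_frontier.mem_iff_infDist_zero hne).2 ?_
  have hA : Tendsto (fun k => infDist (e (t (ψ k))) (frontier D.carrier)) atTop
      (𝓝 (infDist (e t₁) (frontier D.carrier))) :=
    ((continuous_infDist_pt _).tendsto _).comp hek
  have hB : Tendsto (fun k => infDist (e (t (ψ k))) (frontier D.carrier)) atTop (𝓝 0) := by
    refine squeeze_zero (fun k => infDist_nonneg) (fun k => ?_)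
      (by simpa only [add_zero] using herr.add herr)
    calc infDist (e (t (ψ k))) (frontier D.carrier)
        ≤ infDist (γ (ψ k) (t (ψ k))) (frontier D.carrier) +
            dist (e (t (ψ k))) (γ (ψ k) (t (ψ k))) := infDist_le_infDist_add_dist
      _ ≤ 1 / ((ψ k : ℝ) + 1) + 1 / ((ψ k : ℝ) + 1) :=
          add_le_add (hfr (ψ k)).le (hclose (ψ k) _).le
  exact tendsto_nhds_unique hA hB

end Summit.CriticalPhenomena.SAWScalingLimit.Theorems.SimpleSubseqLimits.Boundary.Core

end
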